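import Summits.QuantumFields.BalabanUV.Gaps.D1SymbolPSDCertificate

/-!
# `BalabanUV.Gaps.D1SymbolWardLongitudinal` — cell pub-balaban-gaps, row (D1), seat g1-p1: (5.15) p. 293 [Balaban1987RG1] TYPED FOR ABSTRACT KERNELS — the momentum-space Ward
# identity «the longitudinal vector `∂(t)` annihilates the symbol `P̂(t)`» (row under (5.9), column under (5.9) + (5.8)); `P̂(0) = 0` under (5.9) + absolute summability ALONE; the symbol's
# quadratic form is BLIND to `v ↦ v + c·∂(t)`; hence row 94's certificate REDUCES TO THE TRANSVERSE SUBSPACE at `t ≠ 0` — at the row-(D1) literals: `hW_j` (a theorem at an2's chart-(II)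
# literal) + a transverse certificate for the flipped level-`j` kernel ⟹ `0 ≤ β⁰_j(μ,ν)`

HONEST FRAMING (cell rule, page 1 of everything): [folklore] lattice Fourier bookkeeping about an ABSTRACT kernel `P : B12Beta.Kernel d` — re-indexing of absolutely convergent
character series, continuity of the symbol (row 94's `continuous_tsum_mul_mFourier`), injectivity of `AddCircle.toCircle`; composition BY NAME with row 94 (`D1SymbolPSDCertificate`),
rows 86 ∕ 87, an2's `symmetries_JsRowD1Pin`, GEN 14's index-symmetry dictionary and moment summability.  (5.15) and (5.11) p. 293 are PRINTED for Bałaban's Π and enter here ONLY as the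
shape of identities PROVED for any kernel satisfying the typed predicates (5.9) `WardTransversal` ∕ (5.8) `IndexSymmetric`; NOTHING of Bałaban's is asserted; no symbol is computed or
certified; the Ward binder `hW_j` at the pinned ∕ (III′) literals REMAINS a hypothesis; NO coefficient of Bałaban's computed or signed; (D1) NOT discharged; 0∕4 row-D1 binders at the
pinned ∕ (III′) literals; NOT `BetaPertH`, NOT continuum, NOT Clay.
HONEST DEPENDENCY (b2b cell, verbatim): «continuum YM on T⁴ ⇐ BetaPertH ∧ nine spine estimates (0/9 proved); BetaPertH ⇐ (D1) ∧ (D4) ∧ CAP+tail; G-an2-4 gates asym, D1 and NE2/3/4.»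

CITATION (locator; CONTEXT for the typed identities). T. Bałaban, *Renormalization group approach to lattice gauge field theories. I*, Commun. Math. Phys. **109** (1987) 249–301
[Balaban1987RG1], p. 293: (5.11) *"Π_{μν}(p) = Σ_{x∈Z⁴} e^{−ip·x} Π_{μν}(x)"*; (5.15) *"Σ_μ ∂_μ(−ζ) Π_{μν}(ζ) = Σ_ν ∂_ν(ζ) Π_{μν}(ζ) = 0, (5.15) where ∂_μ(ζ) = e^{iζ_μ} − 1"*; and the
sentence after (5.9): the second identity follows from the first and (5.8).  Here `t = ζ∕2π ∈ (ℝ∕ℤ)^d`, `P̂_{μν}(t) := Σ_z P_{μν}(z) e_{−z}(t)` (`UnitAddTorus.mFourier`), `∂_μ(ζ) = e_{e_μ}(t) − 1`.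

WHY (census row 95 of `HOME/g1/RESIDUE.md`).  Row 94 made the PSD binder equivalent to pointwise positivity of the symbol form and recorded (GEN 18's RESULT-6) that every by-value
screen shows an exact NULL eigenvalue along the Ward longitudinal vector.  This file gives the structural reason — (5.15), typed and proved for abstract kernels — and its two
book-keeping consequences: (i) `P̂(0) = 0` (zeroth moments vanish) from (5.9) + ℓ¹ alone, WITHOUT the first-moment summability that an2's `tsum_eq_zero_of_ward` needs (test (5.15) along
`t = s·e_μ`, `s → 0⁺`); (ii) the symbol form does not see the component of `v` along `∂(t)`, so row 94's certificate needs the form only on `v ⊥ ∂(t)`, `t ≠ 0` — the exact null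
direction is removed from what an engine must enclose.  Located honesty (unchanged from row 94): the transverse eigenvalues still vanish to second order as `t → 0` with curvature the
(1.22) coefficients ((5.16)), so a by-value certificate near `t = 0` is as hard as the sign of `β` itself.
WHAT IT IS NOT: no certificate is produced; `hW_j` (pinned ∕ (III′)), the VALUE side of (D1), (1.21), `D1Tel` ∕ `D1Rep` untouched; the words of the row do not move.

CONTENT (all [folklore] except the two (5.15) identities, which carry the locator; no `def`, no `def … : Prop`, 0 sorry): §1 `symbol_shift`, `symbol_indexSymmetric` (`P̂_{μν}(t) = P̂_{νμ}(−t)`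
under (5.8)), `mFourier_apply_zero`; §2 **`symbol_ward_row`** ((5.15) first identity under (5.9) + ℓ¹); §3 `mFourier_neg_unitVec_axisPoint`, **`tsum_eq_zero_of_ward_summable`** (`Σ_z P_{μν}(z) = 0`
under (5.9) + ℓ¹); §4 **`symbol_ward_col`** ((5.15) second identity under (5.9) + (5.8) + ℓ¹); §5 `conj_longitudinal`, **`symbolForm_add_longitudinal`**; §6 `mFourier_unitVec_apply`,
`eq_zero_of_longitudinal_eq_zero` (`∂(t) = 0 ⟹ t = 0`), **`convPSD_of_symbol_re_nonneg_transverse`**, `mFourier_unitVec_coe_apply`, **`convPSD_of_symbol_re_nonneg_transverse_Ico`** (real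
coordinates `k ∈ [0,1)^d ∖ {0}`, transversality `Σ_μ conj(e^{2πi k_μ} − 1) v_μ = 0`); §7 literals: **`secondMoment_TbalOf_JsRowD1Pin_nonneg_of_symbol_transverse`** (chart-(II):
transverse certificate ALONE ⟹ `0 ≤ β⁰_j`), `secondMoment_TbalOf_JsBalAn1_nonneg_of_hW_symbol_transverse`, `secondMoment_TbalOf_JsB12CombShSym_nonneg_of_hW_symbol_transverse`.

Provenance: cell pub-balaban-gaps, seat g1-p1 GEN 19 (prover-pub-balaban-gaps-g1-p1-g19-0), 2026-08-25∕26 (INTENT-72); imports this seat's row 94 `Gaps/D1SymbolPSDCertificate` (p410843 ✓;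
through it rows 86 ∕ 87 ∕ 92, GEN 14's dictionaries, `Literature/Analysis/FunctionSpaces/TorusTrigPoly`); no existing file touched.
-/

noncomputable section

open MeasureTheory Complex Finset Filter Topology
open scoped ComplexConjugate BigOperators Real

namespace Summit.QuantumFields.BalabanUV.Gaps.D1SymbolWardLongitudinal

open Literature.MathematicalPhysics.QuantumFieldTheory.Balaban1983to89
open Literature.MathematicalPhysics.QuantumFieldTheory.Balaban1983to89.Beta.PolarizationSign (ConvPSD WardTransversal IndexSymmetric)
open Literature.MathematicalPhysics.QuantumFieldTheory.Balaban1983to89.B6BondElimination (unitVec unitVec_apply)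
open UnitAddTorus (mFourier mFourier_neg mFourier_add mFourier_zero)
open Summit.QuantumFields.BalabanUV.Gaps.D1SymbolPSDCertificate (norm_mFourier_apply continuous_tsum_mul_mFourier mFourier_apply_neg convPSD_of_symbol_re_nonneg)

variable {d : ℕ}

/-! ## §1 Symbol algebra: shifts of the site variable, the flip of both indices -/

/-- [folklore] A shift of the site variable multiplies the symbol by a character: `Σ_z P_{μν}(z − e) e_{−z}(t) = e_{−e}(t) · P̂_{μν}(t)` (re-indexing; no summability needed). -/
theorem symbol_shift (P : B12Beta.Kernel d) (μ ν : Fin d) (e : Fin d → ℤ) (t : UnitAddTorus (Fin d)) :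
    ∑' z, (P μ ν (z - e) : ℂ) * mFourier (-z) t = mFourier (-e) t * ∑' z, (P μ ν z : ℂ) * mFourier (-z) t := by
  rw [← tsum_mul_left, ← (Equiv.addRight e).tsum_eq (fun z => (P μ ν (z - e) : ℂ) * mFourier (-z) t)]
  refine tsum_congr fun w => ?_
  simp only [Equiv.coe_addRight, add_sub_cancel_right, neg_add, mFourier_add]
  ring

/-- [folklore] Under the index symmetry (5.8) `P_{μν}(x) = P_{νμ}(−x)` the symbol satisfies `P̂_{μν}(t) = P̂_{νμ}(−t)`. -/
theorem symbol_indexSymmetric {P : B12Beta.Kernel d} (hI : IndexSymmetric P) (μ ν : Fin d) (t : UnitAddTorus (Fin d)) :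
    ∑' z, (P μ ν z : ℂ) * mFourier (-z) t = ∑' z, (P ν μ z : ℂ) * mFourier (-z) (-t) := by
  rw [← (Equiv.neg (Fin d → ℤ)).tsum_eq (fun z => (P ν μ z : ℂ) * mFourier (-z) (-t))]
  refine tsum_congr fun z => ?_
  simp only [Equiv.neg_apply, neg_neg, hI μ ν z, mFourier_apply_neg]

/-! ## §2 (5.15) p. 293, FIRST IDENTITY — the momentum-space Ward identity: the longitudinal ROW vector annihilates the symbol -/

/-- [cite: Balaban1987RG1, (5.15) p.293] **THE WARD IDENTITY IN MOMENTUM SPACE, FIRST IDENTITY** — printed: *"Σ_μ ∂_μ(−ζ) Π_{μν}(ζ) = Σ_ν ∂_ν(ζ) Π_{μν}(ζ) = 0, (5.15) where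
∂_μ(ζ) = e^{iζ_μ} − 1"* with (5.11) *"Π_{μν}(p) = Σ_{x∈Z⁴} e^{−ip·x} Π_{μν}(x)"*.  Typed for an ABSTRACT kernel `P : B12Beta.Kernel d` with absolutely summable entries satisfying the
position-space Ward identity (5.9) (`PolarizationSign.WardTransversal`), at the point `t = ζ∕2π` of the dual torus, `P̂_{μν}(t) := Σ_z P_{μν}(z) e_{−z}(t)`, `∂_μ(−ζ) = e_{−e_μ}(t) − 1`:
`Σ_μ (e_{−e_μ}(t) − 1) P̂_{μν}(t) = 0`.  (A PREDICATE-LEVEL identity: nothing about Bałaban's Π is asserted.) -/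
theorem symbol_ward_row {P : B12Beta.Kernel d} (hS : ∀ μ ν, Summable fun z => |P μ ν z|) (hW : WardTransversal P) (ν : Fin d) (t : UnitAddTorus (Fin d)) :
    ∑ μ, (mFourier (-unitVec μ) t - 1) * ∑' z, (P μ ν z : ℂ) * mFourier (-z) t = 0 := by
  have hsum : ∀ μ (e : Fin d → ℤ), Summable fun z => (P μ ν (z - e) : ℂ) * mFourier (-z) t := by
    intro μ e
    refine Summable.of_norm_bounded ((Equiv.subRight e).summable_iff.mpr (hS μ ν)) fun z => ?_
    rw [norm_mul, norm_mFourier_apply, mul_one, Complex.norm_real, Real.norm_eq_abs]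
    exact le_of_eq rfl
  calc ∑ μ, (mFourier (-unitVec μ) t - 1) * ∑' z, (P μ ν z : ℂ) * mFourier (-z) t
      = ∑ μ, (∑' z, (P μ ν (z - unitVec μ) : ℂ) * mFourier (-z) t - ∑' z, (P μ ν z : ℂ) * mFourier (-z) t) :=
        Finset.sum_congr rfl fun μ _ => by rw [symbol_shift, sub_mul, one_mul]
    _ = ∑ μ, ∑' z, ((P μ ν (z - unitVec μ) : ℂ) - P μ ν z) * mFourier (-z) t :=
        Finset.sum_congr rfl fun μ _ => by
          rw [← Summable.tsum_sub (hsum μ (unitVec μ)) (by simpa only [sub_zero] using hsum μ 0)]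
          exact tsum_congr fun z => by ring
    _ = ∑' z, ∑ μ, ((P μ ν (z - unitVec μ) : ℂ) - P μ ν z) * mFourier (-z) t := by
        rw [Summable.tsum_finsetSum fun μ _ => ?_]
        exact ((hsum μ (unitVec μ)).sub (by simpa only [sub_zero] using hsum μ 0)).congr fun z => by ring
    _ = 0 := by
        refine (tsum_congr fun z => ?_).trans tsum_zero
        rw [← Finset.sum_mul]
        have h := hW ν z
        have h' : ∑ μ, ((P μ ν (z - unitVec μ) : ℂ) - P μ ν z) = 0 := by exact_mod_cast h
        rw [h', zero_mul]

/-- [folklore] `e_n(0) = 1`. -/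
theorem mFourier_apply_zero (n : Fin d → ℤ) : mFourier n (0 : UnitAddTorus (Fin d)) = 1 := by
  simp only [mFourier, ContinuousMap.coe_mk, Pi.zero_apply, fourier_eval_zero, Finset.prod_const_one]

/-! ## §3 Zeroth moments vanish under (5.9) + absolute summability ALONE: `P̂(0) = 0` (the row identity along `t = s·e_μ`, `s → 0⁺`, and continuity of the symbol) -/

/-- [folklore] The point `s·e_μ mod ℤ^d` of the dual torus. -/
theorem mFourier_neg_unitVec_axisPoint (α μ : Fin d) (s : ℝ) :
    mFourier (-unitVec α) (fun i => if i = μ then ((s : ℝ) : UnitAddCircle) else 0) = if α = μ then cexp (-(2 * π * I) * s) else 1 := by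
  simp only [mFourier, ContinuousMap.coe_mk, Pi.neg_apply, unitVec_apply]
  rw [Finset.prod_eq_single α (fun i _ hi => by simp [hi]) (fun h => absurd (Finset.mem_univ α) h)]
  simp only [if_true]
  split_ifs with h
  · rw [fourier_coe_apply]; congr 1; push_cast; ring
  · simp

/-- [folklore] **ZEROTH MOMENTS VANISH UNDER THE WARD IDENTITY AND ABSOLUTE SUMMABILITY ALONE**: `Σ_z P_{μν}(z) = 0` for every `μ, ν` — i.e. `P̂(0) = 0` (compare the β sub-cell's
`PolarizationSign.tsum_eq_zero_of_ward`, which tests (5.9) against the weight `z ↦ z_α` and therefore assumes summable first moments).  Proof: along the axis `t_s = s·e_μ` the row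
identity (5.15) reads `(e^{−2πis} − 1) P̂_{μν}(t_s) = 0`, so `P̂_{μν}(t_s) = 0` for `0 < s < 1`; let `s → 0⁺` (the symbol is continuous). -/
theorem tsum_eq_zero_of_ward_summable {P : B12Beta.Kernel d} (hS : ∀ μ ν, Summable fun z => |P μ ν z|) (hW : WardTransversal P) (μ ν : Fin d) :
    ∑' z, (P μ ν z : ℂ) = 0 := by
  -- the symbol entry and the axis path
  set S : UnitAddTorus (Fin d) → ℂ := fun t => ∑' z, (P μ ν z : ℂ) * mFourier (-z) t with hSdef
  set path : ℝ → UnitAddTorus (Fin d) := fun s i => if i = μ then ((s : ℝ) : UnitAddCircle) else 0 with hpath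
  have hSc : Continuous S := continuous_tsum_mul_mFourier hS μ ν fun z => -z
  have hpc : Continuous path := continuous_pi fun i => by
    by_cases h : i = μ
    · simp only [hpath, h, if_true]; exact AddCircle.continuous_mk' (1 : ℝ) |>.comp continuous_id
    · simp only [hpath, h, if_false]; exact continuous_const
  -- along the path, off the lattice, the entry vanishes
  have hvan : ∀ s : ℝ, 0 < s → s < 1 → S (path s) = 0 := by
    intro s hs0 hs1
    have h := symbol_ward_row hS hW ν (path s)
    have hterm : ∀ α, (mFourier (-unitVec α) (path s) - 1) * ∑' z, (P α ν z : ℂ) * mFourier (-z) (path s)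
        = if α = μ then (cexp (-(2 * π * I) * s) - 1) * S (path s) else 0 := by
      intro α
      rw [hpath, mFourier_neg_unitVec_axisPoint]
      split_ifs with hα
      · subst hα; rfl
      · rw [sub_self, zero_mul]
    simp_rw [hterm] at h
    rw [Finset.sum_ite_eq' Finset.univ μ, if_pos (Finset.mem_univ μ)] at h
    have hne : cexp (-(2 * π * I) * s) - 1 ≠ 0 := by
      rw [sub_ne_zero, Ne, Complex.exp_eq_one_iff]
      rintro ⟨n, hn⟩
      have hre := congrArg Complex.im hn
      simp at hre
      have h1 : (s : ℝ) = -n := by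
        have hπ : Real.pi ≠ 0 := Real.pi_ne_zero
        field_simp at hre
        linarith
      have h2 : (0 : ℝ) < -(n : ℝ) := h1 ▸ hs0
      have h3 : -(n : ℝ) < 1 := h1 ▸ hs1
      have h4 : n < 0 := by exact_mod_cast (neg_pos.mp h2)
      have h5 : -1 < n := by
        have : (-(n : ℝ)) < 1 := h3
        have : (-1 : ℝ) < n := by linarith
        exact_mod_cast this
      omega
    exact (mul_eq_zero.mp h).resolve_left hne
  -- the limit s → 0⁺
  have hlim : Tendsto (fun s => S (path s)) (𝓝[>] 0) (𝓝 (S (path 0))) :=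
    ((hSc.comp hpc).tendsto 0).mono_left nhdsWithin_le_nhds
  have hev : (fun s => S (path s)) =ᶠ[𝓝[>] 0] fun _ => 0 := by
    filter_upwards [Ioo_mem_nhdsGT (zero_lt_one' ℝ)] with s hs using hvan s hs.1 hs.2
  have h0 : S (path 0) = 0 := tendsto_nhds_unique (hlim.congr' hev) tendsto_const_nhds
  have hp0 : path 0 = 0 := by
    funext i; simp only [hpath]; split_ifs <;> simp
  rw [hp0, hSdef] at h0
  have h0' : ∑' z, (P μ ν z : ℂ) * mFourier (-z) 0 = 0 := by simpa only using h0
  rw [← h0']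
  exact tsum_congr fun z => by rw [mFourier_apply_zero, mul_one]


/-! ## §4 (5.15) p. 293, SECOND IDENTITY (under (5.8)): the symbol annihilates the longitudinal COLUMN vector -/

/-- [cite: Balaban1987RG1, (5.15) p.293] **THE WARD IDENTITY IN MOMENTUM SPACE, SECOND IDENTITY** — printed: *"Σ_ν ∂_ν(ζ) Π_{μν}(ζ) = 0"* (p. 293: the second identity of (5.9) follows
from the first and the symmetry (5.8)).  Typed for an abstract absolutely summable kernel with (5.9) (`WardTransversal`) and (5.8) (`IndexSymmetric`):
`Σ_ν P̂_{μν}(t) (e_{e_ν}(t) − 1) = 0` — the first identity at `−t` transported by `P̂_{μν}(t) = P̂_{νμ}(−t)`. -/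
theorem symbol_ward_col {P : B12Beta.Kernel d} (hS : ∀ μ ν, Summable fun z => |P μ ν z|) (hW : WardTransversal P) (hI : IndexSymmetric P) (μ : Fin d)
    (t : UnitAddTorus (Fin d)) : ∑ ν, (∑' z, (P μ ν z : ℂ) * mFourier (-z) t) * (mFourier (unitVec ν) t - 1) = 0 := by
  have h := symbol_ward_row hS hW μ (-t)
  calc ∑ ν, (∑' z, (P μ ν z : ℂ) * mFourier (-z) t) * (mFourier (unitVec ν) t - 1)
      = ∑ ν, (mFourier (-unitVec ν) (-t) - 1) * ∑' z, (P ν μ z : ℂ) * mFourier (-z) (-t) :=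
        Finset.sum_congr rfl fun ν _ => by rw [symbol_indexSymmetric hI μ ν t, mFourier_apply_neg, neg_neg, mul_comm]
    _ = 0 := h

/-! ## §5 The symbol's quadratic form is BLIND TO THE LONGITUDINAL DIRECTION `∂(t) = (e_{e_μ}(t) − 1)_μ` -/

/-- [folklore] `conj (e_{e_μ}(t) − 1) = e_{−e_μ}(t) − 1` (= the printed `∂_μ(−ζ)`). -/
theorem conj_longitudinal (μ : Fin d) (t : UnitAddTorus (Fin d)) : conj (mFourier (unitVec μ) t - 1) = mFourier (-unitVec μ) t - 1 := by
  rw [map_sub, map_one, ← mFourier_neg]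

/-- [folklore] **THE SYMBOL FORM IS INVARIANT UNDER `v ↦ v + c·∂(t)`** (`∂(t)_μ = e_{e_μ}(t) − 1`): under (5.9) + (5.8) + absolute summability, for every `t`, `v ∈ ℂ^d`, `c ∈ ℂ`,
`Σ_{μν} conj(v_μ + c ∂_μ) P̂_{μν}(t) (v_ν + c ∂_ν) = Σ_{μν} conj(v_μ) P̂_{μν}(t) v_ν` — the cross and square terms are the two identities (5.15).  This is the structural reason for the
null eigenvalue along `∂(t)` seen in every by-value symbol screen. -/
theorem symbolForm_add_longitudinal {P : B12Beta.Kernel d} (hS : ∀ μ ν, Summable fun z => |P μ ν z|) (hW : WardTransversal P) (hI : IndexSymmetric P)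
    (t : UnitAddTorus (Fin d)) (v : Fin d → ℂ) (c : ℂ) :
    ∑ μ, ∑ ν, conj (v μ + c * (mFourier (unitVec μ) t - 1)) * (∑' z, (P μ ν z : ℂ) * mFourier (-z) t) * (v ν + c * (mFourier (unitVec ν) t - 1))
      = ∑ μ, ∑ ν, conj (v μ) * (∑' z, (P μ ν z : ℂ) * mFourier (-z) t) * v ν := by
  obtain ⟨S, hSapp⟩ : ∃ S : Fin d → Fin d → ℂ, ∀ μ ν, ∑' z, (P μ ν z : ℂ) * mFourier (-z) t = S μ ν := ⟨_, fun _ _ => rfl⟩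
  obtain ⟨ℓ, hℓapp⟩ : ∃ ℓ : Fin d → ℂ, ∀ μ, mFourier (unitVec μ) t - 1 = ℓ μ := ⟨_, fun _ => rfl⟩
  have hrow : ∀ ν, ∑ μ, conj (ℓ μ) * S μ ν = 0 := fun ν => by
    have h := symbol_ward_row hS hW ν t
    simp_rw [← conj_longitudinal, hℓapp, hSapp] at h
    exact h
  have hcol : ∀ μ, ∑ ν, S μ ν * ℓ ν = 0 := fun μ => by
    have h := symbol_ward_col hS hW hI μ t
    simp_rw [hℓapp, hSapp] at h
    exact h
  simp_rw [hSapp, hℓapp]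
  have e : ∀ μ ν, conj (v μ + c * ℓ μ) * S μ ν * (v ν + c * ℓ ν)
      = conj (v μ) * S μ ν * v ν + c * (conj (v μ) * (S μ ν * ℓ ν)) + (conj c * (v ν + c * ℓ ν)) * (conj (ℓ μ) * S μ ν) := by
    intro μ ν; simp only [map_add, map_mul]; ring
  simp_rw [e, Finset.sum_add_distrib]
  have h2 : ∑ μ, ∑ ν, c * (conj (v μ) * (S μ ν * ℓ ν)) = 0 :=
    Finset.sum_eq_zero fun μ _ => by rw [← Finset.mul_sum, ← Finset.mul_sum, hcol μ, mul_zero, mul_zero]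
  have h3 : ∑ μ, ∑ ν, (conj c * (v ν + c * ℓ ν)) * (conj (ℓ μ) * S μ ν) = 0 := by
    rw [Finset.sum_comm]
    exact Finset.sum_eq_zero fun ν _ => by rw [← Finset.mul_sum, hrow ν, mul_zero]
  rw [h2, h3, add_zero, add_zero]

/-! ## §6 The transverse reduction of the certificate: it suffices to check the symbol form on `v ⊥ ∂(t)`, `t ≠ 0` -/

/-- [folklore] `e_{e_μ}(t) = fourier 1 (t_μ)`. -/
theorem mFourier_unitVec_apply (μ : Fin d) (t : UnitAddTorus (Fin d)) : mFourier (unitVec μ) t = fourier 1 (t μ) := by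
  simp only [mFourier, ContinuousMap.coe_mk, unitVec_apply]
  rw [Finset.prod_eq_single μ (fun i _ hi => by simp [hi]) (fun h => absurd (Finset.mem_univ μ) h)]
  simp

/-- [folklore] The longitudinal vector `∂(t)` vanishes only at `t = 0`. -/
theorem eq_zero_of_longitudinal_eq_zero (t : UnitAddTorus (Fin d)) (h : ∀ μ, mFourier (unitVec μ) t - 1 = 0) : t = 0 := by
  funext μ
  have h1 : fourier 1 (t μ) = fourier 1 (0 : UnitAddCircle) := by rw [← mFourier_unitVec_apply, sub_eq_zero.mp (h μ), fourier_eval_zero]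
  simp only [fourier_one] at h1
  exact AddCircle.injective_toCircle one_ne_zero (Circle.coe_inj.mp h1)

/-- [folklore] **THE TRANSVERSE CERTIFICATE.**  Under (5.9) + (5.8) + absolute summability it suffices, for `ConvPSD P`, that at every `t ≠ 0` of the dual torus the symbol form has
nonnegative real part on the vectors TRANSVERSE to `∂(t)` (`Σ_μ conj(∂_μ(t)) v_μ = 0`): at `t = 0` the symbol vanishes (`P̂(0) = 0`, §3), and elsewhere `v = w + c·∂(t)` with `w`
transverse and the form of `v` equals the form of `w` (§5).  (Honesty: the transverse eigenvalues still degenerate as `t → 0` — to second order, with curvature the (1.22)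
coefficients, cf. (5.16) p. 293 — so a by-value certificate near `t = 0` is as hard as the sign of `β` itself; this theorem removes only the exact null direction.) -/
theorem convPSD_of_symbol_re_nonneg_transverse {P : B12Beta.Kernel d} (hS : ∀ μ ν, Summable fun z => |P μ ν z|) (hW : WardTransversal P) (hI : IndexSymmetric P)
    (hpsd : ∀ t : UnitAddTorus (Fin d), t ≠ 0 → ∀ v : Fin d → ℂ, ∑ μ, conj (mFourier (unitVec μ) t - 1) * v μ = 0 →
      0 ≤ (∑ μ, ∑ ν, conj (v μ) * (∑' z, (P μ ν z : ℂ) * mFourier (-z) t) * v ν).re) :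
    ConvPSD P := by
  refine convPSD_of_symbol_re_nonneg hS fun t v => ?_
  by_cases ht : t = 0
  · subst ht
    have h0 : ∀ μ ν, ∑' z, (P μ ν z : ℂ) * mFourier (-z) (0 : UnitAddTorus (Fin d)) = 0 := fun μ ν => by
      rw [← tsum_eq_zero_of_ward_summable hS hW μ ν]
      exact tsum_congr fun z => by rw [mFourier_apply_zero, mul_one]
    simp only [h0, mul_zero, zero_mul, Finset.sum_const_zero, Complex.zero_re, le_refl]
  · obtain ⟨ℓ, hℓapp⟩ : ∃ ℓ : Fin d → ℂ, ∀ μ, mFourier (unitVec μ) t - 1 = ℓ μ := ⟨_, fun _ => rfl⟩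
    have hℓ : ∃ μ, ℓ μ ≠ 0 := by
      by_contra h
      exact ht (eq_zero_of_longitudinal_eq_zero t fun μ => (hℓapp μ).trans (not_not.mp (not_exists.mp h μ)))
    obtain ⟨μ₀, hμ₀⟩ := hℓ
    -- the normalisation `n = Σ |∂_μ|² > 0`
    set n : ℝ := ∑ μ, Complex.normSq (ℓ μ) with hndef
    have hnpos : 0 < n := lt_of_lt_of_le (Complex.normSq_pos.mpr hμ₀) (Finset.single_le_sum (f := fun μ => Complex.normSq (ℓ μ)) (fun μ _ => Complex.normSq_nonneg _) (Finset.mem_univ μ₀))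
    have hn : ∑ μ, conj (ℓ μ) * ℓ μ = (n : ℂ) := by
      rw [hndef]; push_cast; exact Finset.sum_congr rfl fun μ _ => (Complex.normSq_eq_conj_mul_self).symm
    have hn0 : (n : ℂ) ≠ 0 := by exact_mod_cast hnpos.ne'
    -- the transverse part
    set c : ℂ := (∑ μ, conj (ℓ μ) * v μ) / n with hcdef
    set w : Fin d → ℂ := fun μ => v μ - c * ℓ μ with hwdef
    have hw : ∑ μ, conj (ℓ μ) * w μ = 0 := by
      simp only [hwdef, mul_sub, Finset.sum_sub_distrib]
      rw [show ∑ μ, conj (ℓ μ) * (c * ℓ μ) = c * ∑ μ, conj (ℓ μ) * ℓ μ by rw [Finset.mul_sum]; exact Finset.sum_congr rfl fun μ _ => by ring, hn, hcdef,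
        div_mul_cancel₀ _ hn0, sub_self]
    have hv : ∀ μ, v μ = w μ + c * ℓ μ := fun μ => by simp only [hwdef, sub_add_cancel]
    have key := symbolForm_add_longitudinal hS hW hI t w c
    simp_rw [hℓapp] at key
    have hwt := hpsd t ht w (by simp_rw [hℓapp]; exact hw)
    rw [← key] at hwt
    convert hwt using 4 with μ _ ν _
    rw [hv μ, hv ν]


/-- [folklore] `e_{e_μ}(k mod ℤ^d) = e^{2πi k_μ}`. -/
theorem mFourier_unitVec_coe_apply (μ : Fin d) (k : Fin d → ℝ) : mFourier (unitVec μ) (fun i => ((k i : ℝ) : UnitAddCircle)) = cexp (2 * π * I * (k μ : ℂ)) := by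
  rw [mFourier_unitVec_apply, fourier_coe_apply]
  congr 1; push_cast; ring

/-- [folklore] **THE TRANSVERSE CERTIFICATE IN REAL COORDINATES** (the statement an engine targets): under (5.9) + (5.8) + absolute summability, if for every `k ∈ [0,1)^d`, `k ≠ 0`, and
every `v ∈ ℂ^d` with `Σ_μ conj(e^{2πi k_μ} − 1) v_μ = 0` one has `0 ≤ Re Σ_{μν} conj(v_μ) (Σ_z P_{μν}(z) e^{−2πi k·z}) v_ν`, then `ConvPSD P`. -/
theorem convPSD_of_symbol_re_nonneg_transverse_Ico {P : B12Beta.Kernel d} (hS : ∀ μ ν, Summable fun z => |P μ ν z|) (hW : WardTransversal P) (hI : IndexSymmetric P)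
    (hpsd : ∀ k : Fin d → ℝ, (∀ i, k i ∈ Set.Ico (0 : ℝ) 1) → k ≠ 0 → ∀ v : Fin d → ℂ, ∑ μ, conj (cexp (2 * π * I * (k μ : ℂ)) - 1) * v μ = 0 →
      0 ≤ (∑ μ, ∑ ν, conj (v μ) * (∑' z, (P μ ν z : ℂ) * cexp (-(2 * π * I) * ∑ i, (k i : ℂ) * (z i : ℂ))) * v ν).re) :
    ConvPSD P := by
  refine convPSD_of_symbol_re_nonneg_transverse hS hW hI fun t ht v hv => ?_
  obtain ⟨k, hk, rfl⟩ := Summit.QuantumFields.BalabanUV.Gaps.D1SymbolPSDCertificate.exists_Ico_coe_eq t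
  have hk0 : k ≠ 0 := by
    rintro rfl
    exact ht (funext fun i => by simp)
  simp_rw [mFourier_unitVec_coe_apply] at hv
  simpa only [Summit.QuantumFields.BalabanUV.Gaps.D1SymbolPSDCertificate.mFourier_neg_coe_apply] using hpsd k hk hk0 v hv

/-! ## §7 At the row-(D1) literals (`d = 4`): the transverse certificate for the flipped level-`j` kernel -/

section Literals

open Literature.MathematicalPhysics.QuantumFieldTheory.Balaban1983to89.Beta
open OneStepResolventKernel (JetData)
open OneStepKernelFamily (TbalOf flipK)
open Literature.MathematicalPhysics.QuantumFieldTheory.Balaban1983to89.Beta.PolarizationSign (MomentSummable)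
open Summit.QuantumFields.BalabanUV.Beta.MixedJetTablesPlug (JsBalAn1)
open Summit.QuantumFields.BalabanUV.Beta.CombChartJointEnd (JsB12CombShSym)
open Summit.QuantumFields.BalabanUV.Beta.SymmetrisedStepJets (SymTables)
open Summit.QuantumFields.BalabanUV.Beta.RowD1JointEnd (JsRowD1Pin)
open Summit.QuantumFields.BalabanUV.Beta.RowD1SymmetriesDischarged (symmetries_JsRowD1Pin)
open Summit.QuantumFields.BalabanUV.Gaps.D1IndexSymmetryDictionary (momentSummable_flipK_TbalOf)
open Summit.QuantumFields.BalabanUV.Gaps.D1PinnedIndexSymmetry (indexSymmetric_flipK_TbalOf_JsBalAn1)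
open Summit.QuantumFields.BalabanUV.Gaps.D1RecordIndexSymmetry (indexSymmetric_flipK_TbalOf_JsB12CombShSym)
open Summit.QuantumFields.BalabanUV.Gaps.D1CoDressedLongitudinalForm (indexSymmetric_flipK_TbalOf_JsRowD1Pin secondMoment_TbalOf_JsRowD1Pin_nonneg_of_convPSD)
open Summit.QuantumFields.BalabanUV.Gaps.D1WardLongitudinalForm (secondMoment_TbalOf_JsBalAn1_nonneg_of_hW_convPSD secondMoment_TbalOf_JsB12CombShSym_nonneg_of_hW_convPSD)

variable {Lc : ℕ} [NeZero Lc]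

/-- [folklore] **AN2's CHART-(II) LITERAL `JsRowD1Pin hLc N` (`Odd Lc`, `2 ≤ N`; hW ∧ (5.8) THEOREMS): A TRANSVERSE CERTIFICATE FOR THE FLIPPED LEVEL-`j` KERNEL ALONE GIVES `0 ≤ β⁰_j(μ,ν)`**
(`μ ≠ ν`): for `K_j := flipK (TbalOf Lc (JsRowD1Pin hLc N) j)` it suffices that at every `t ≠ 0` of `(ℝ∕ℤ)^4` and every `v ⊥ ∂(t)`, `0 ≤ Re Σ_{μν} conj(v_μ) K̂_j(μ,ν,t) v_ν`. -/
theorem secondMoment_TbalOf_JsRowD1Pin_nonneg_of_symbol_transverse (hLc : Odd Lc) {N : ℕ} (hN : 2 ≤ N) (j : ℕ)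
    (hpsd : ∀ t : UnitAddTorus (Fin 4), t ≠ 0 → ∀ v : Fin 4 → ℂ, ∑ μ, conj (mFourier (unitVec μ) t - 1) * v μ = 0 →
      0 ≤ (∑ μ, ∑ ν, conj (v μ) * (∑' z, (flipK (TbalOf Lc (JsRowD1Pin hLc N) j) μ ν z : ℂ) * mFourier (-z) t) * v ν).re)
    {μ ν : Fin 4} (hμν : μ ≠ ν) : 0 ≤ B12Beta.secondMoment (TbalOf Lc (JsRowD1Pin hLc N) j) μ ν :=
  secondMoment_TbalOf_JsRowD1Pin_nonneg_of_convPSD hLc hN j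
    (convPSD_of_symbol_re_nonneg_transverse (fun μ ν => (momentSummable_flipK_TbalOf _ j 0).summable_abs μ ν) ((symmetries_JsRowD1Pin hLc hN).1 j)
      (indexSymmetric_flipK_TbalOf_JsRowD1Pin hLc N j) hpsd) hμν

variable {r : Fin (3 + 1) → ℕ}

/-- [folklore] **THE β-LEAD's PINNED FAMILY `JsBalAn1 …` ((5.8) a THEOREM, GEN 14): `hW_j` + A TRANSVERSE CERTIFICATE FOR `K_j := flipK (TbalOf …) j` ⟹ `0 ≤ β⁰_j(μ,ν)`** (`μ ≠ ν`; any `1 ≤ Lc`, root,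
colours, `cE₂`, `cB`, `T`). -/
theorem secondMoment_TbalOf_JsBalAn1_nonneg_of_hW_symbol_transverse (hLc : 1 ≤ Lc) (hr : r ∈ AffineAveraging.box (3 + 1) Lc) (cE cVH cΛ cE₂ cB : ℝ)
    (T : Fin 4 → Fin 4 → Fin 4 → Fin 4 → ℝ) (j : ℕ) (hW : WardTransversal (flipK (TbalOf Lc (JsBalAn1 hLc hr cE cVH cΛ cE₂ cB T) j)))
    (hpsd : ∀ t : UnitAddTorus (Fin 4), t ≠ 0 → ∀ v : Fin 4 → ℂ, ∑ μ, conj (mFourier (unitVec μ) t - 1) * v μ = 0 →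
      0 ≤ (∑ μ, ∑ ν, conj (v μ) * (∑' z, (flipK (TbalOf Lc (JsBalAn1 hLc hr cE cVH cΛ cE₂ cB T) j) μ ν z : ℂ) * mFourier (-z) t) * v ν).re)
    {μ ν : Fin 4} (hμν : μ ≠ ν) : 0 ≤ B12Beta.secondMoment (TbalOf Lc (JsBalAn1 hLc hr cE cVH cΛ cE₂ cB T) j) μ ν :=
  secondMoment_TbalOf_JsBalAn1_nonneg_of_hW_convPSD hLc hr cE cVH cΛ cE₂ cB T j hW
    (convPSD_of_symbol_re_nonneg_transverse (fun μ ν => (momentSummable_flipK_TbalOf _ j 0).summable_abs μ ν) hW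
      (indexSymmetric_flipK_TbalOf_JsBalAn1 hLc hr cE cVH cΛ cE₂ cB T j) hpsd) hμν

/-- [folklore] **THE b2b WALL's (III′) LITERAL `JsB12CombShSym hLc N tabs cΛ cB` (every table record; `Odd Lc`; (5.8) a THEOREM, GEN 14): `hW_j` + A TRANSVERSE CERTIFICATE FOR
`K_j := flipK (TbalOf …) j` ⟹ `0 ≤ β⁰_j(μ,ν)`** (`μ ≠ ν`). -/
theorem secondMoment_TbalOf_JsB12CombShSym_nonneg_of_hW_symbol_transverse (hLc : Odd Lc) (N : ℕ) (tabs : SymTables 3 Lc) (cΛ cB : ℝ) (j : ℕ)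
    (hW : WardTransversal (flipK (TbalOf Lc (JsB12CombShSym hLc N tabs cΛ cB) j)))
    (hpsd : ∀ t : UnitAddTorus (Fin 4), t ≠ 0 → ∀ v : Fin 4 → ℂ, ∑ μ, conj (mFourier (unitVec μ) t - 1) * v μ = 0 →
      0 ≤ (∑ μ, ∑ ν, conj (v μ) * (∑' z, (flipK (TbalOf Lc (JsB12CombShSym hLc N tabs cΛ cB) j) μ ν z : ℂ) * mFourier (-z) t) * v ν).re)
    {μ ν : Fin 4} (hμν : μ ≠ ν) : 0 ≤ B12Beta.secondMoment (TbalOf Lc (JsB12CombShSym hLc N tabs cΛ cB) j) μ ν :=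
  secondMoment_TbalOf_JsB12CombShSym_nonneg_of_hW_convPSD hLc N tabs cΛ cB j hW
    (convPSD_of_symbol_re_nonneg_transverse (fun μ ν => (momentSummable_flipK_TbalOf _ j 0).summable_abs μ ν) hW
      (indexSymmetric_flipK_TbalOf_JsB12CombShSym hLc N tabs cΛ cB j) hpsd) hμν

end Literals

end Summit.QuantumFields.BalabanUV.Gaps.D1SymbolWardLongitudinal
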